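import Mathlib
import Summits.Ventures.PercRepro2.HCov
import Summits.Ventures.PercRepro2.BHKOutside
import Summits.Ventures.PercRepro2.YDeltaTools
import Summits.Ventures.PercRepro2.DiagBA3
import Summits.Ventures.PercRepro2.HCovPlusQuartic
import Summits.Ventures.PercRepro2.QuarticRootCross

/-!
# THE `oL` HALF OF THE ROOT-EDGE CROSS TERM IS A THEOREM (blind cell PercRepro2, p5 g18;
`proofs/P5-OEDGE.md` §23 / §24)

`QuarticRootCross.covUm_root_decomp` writes the cross term `c = covUm` of the quartic's root-edge
face (`e = {a₁, a₃}`) as `D₀·P₀(PD, o ↔ a₃) + [D₀·P₀(T′, o ∈ U) − Do₀·P₀(T′)]`, and the bracket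
splits into an `oH` half `D₀·P₀(T′, oH) − P₀(PD, oH)·P₀(T′) ≤ 0` (the cell's margin block
`DiagBA3.T'oH_mul_D_le`, BHK06 Thm 1.4) and an `oL` half
`D₀·P₀(T′, oL) − P₀(PD, oL)·P₀(T′)`, i.e. `P(oL | T′) ≥ P(oL | PD)`, recorded in §23 as
census-true (1,395 / 1,395) and «not a consequence of BHK06 Thm 1.3 + the margin lemma».

It IS a consequence of BHK06 Thm 1.3 in its set-avoidance functional form: with `R′ := {a₂ ↮ a₁,
a₂ ↮ a₃}` one has `T′ = R′ ∩ {a₁ ↔ a₃}` and `PD = R′ ∩ {a₁ ↮ a₃}`, so the claim is that, conditionally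
on `R′` (the cluster of `a₂` avoids `{a₁, a₃}`), the two events `{o ∈ C₁}` and `{a₃ ∈ C₁}` — both
cluster events of `a₁` OFF the explored cluster of `a₂` — are positively correlated. That is
exactly `bhk_two_outside_avoid` (mine-2 g17, `BHKOutside.lean`) with `s = a₂`, `u = v = a₁`,
`X = {a₁, a₃}`: explore `C(a₂) = W`; on each fibre Harris on `G ∖ W` gives the positive correlation
of the two increasing events; the between-fibre covariance of the two antitone fibre
probabilities is nonnegative by the functional BHK inequality `bhk_induced` for the conditioned
cluster `C(a₂)`.

* **`PDoL_mul_T'_le`**: `P(PD, oL)·P(T′) ≤ P(T′, oL)·D` — the `oL` half (`oL = {o ∈ C₁}`);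
* **`PDoH_mul_T_le`**: its root swap `P(PD, oH)·P(T) ≤ P(T, oH)·D`;
* **`covUm_root_ge`**: `c ≥ D₀·P₀(PD, o ↔ a₃) + [D₀·P₀(T′, oH) − P₀(PD, oH)·P₀(T′)]` — the cross term
  is bounded below by the `a₃`-cluster mass of `o` minus the `oH` anti-correlation deficit;
* **`covUm_root_add_oH_deficit_nonneg`**: `0 ≤ c + [P₀(PD, oH)·P₀(T′) − D₀·P₀(T′, oH)]` — the
  negative part of `c` is at most the `oH` deficit `δ_oH ≥ 0` (`oH_deficit_nonneg`).

So the open root-edge face of the quartic road (`0 ≤ H1 ∧ 0 ≤ H2`, `HCovPlusQuartic.H1_eq_root` /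
`H2_eq_root`) now rests on the `oH` deficit alone: `H2 = Q₀B2 + Q₁B1 + c·slackBm ≥ Q₀B2 + Q₁B1 −
δ_oH·slackBm` wherever `slackBm ≥ 0`. Nothing here closes the face; `c < 0` does occur (7 / 12,600
root-edge lines, §22), and there the `oH` deficit exceeds the two nonnegative pieces.
-/

namespace Summit.Ventures.PercRepro2

open UnionCluster CovForm HCovPlusQuartic

namespace QuarticRootCross

section OL

variable {V : Type*} {E : Type*} [Fintype V] [DecidableEq V] [Fintype E] [DecidableEq E]
  {R : Type*} [Field R] [LinearOrder R] [IsStrictOrderedRing R]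

omit [Fintype V] [Fintype E] [DecidableEq E] in
/-- `{o ∈ C₁} ∩ {a₁ ↔ a₃} ∩ R′ = T′ ∩ {o ∈ C₁}` with `R′ = {a₂ ↮ a₁, a₂ ↮ a₃}`. -/
lemma oL_inter_conn13_inter_R' (ends : E → Sym2 V) (o a₁ a₂ a₃ : V) :
    connEvent ends a₁ o ∩ connEvent ends a₁ a₃ ∩ avoidAll ends a₂ {a₁, a₃} =
      TEvent ends a₂ a₁ a₃ ∩ connEvent ends a₁ o := by
  ext ω
  simp only [Set.mem_inter_iff, mem_connEvent, mem_avoidAll, Finset.mem_insert,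
    Finset.mem_singleton, forall_eq_or_imp, forall_eq, TEvent, Set.mem_compl_iff]
  constructor
  · rintro ⟨⟨ho, h13⟩, h21, _⟩
    exact ⟨⟨fun h => h21 (conn_symm h), h13⟩, ho⟩
  · rintro ⟨⟨h12, h13⟩, ho⟩
    exact ⟨⟨ho, h13⟩, fun h => h12 (conn_symm h), fun h => h12 (conn_trans h13 (conn_symm h))⟩

/-- **The `oL` half of the root-edge bracket is a theorem** (`bhk_two_outside_avoid` with `s = a₂`,
`u = v = a₁`, `X = {a₁, a₃}`): `P(PD, oL) · P(T′) ≤ P(T′, oL) · D`, i.e. `P(oL | PD) ≤ P(oL | T′)`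
— conditionally on `{a₂ ↮ a₁, a₂ ↮ a₃}`, the cluster events `{o ∈ C₁}` and `{a₃ ∈ C₁}` off the
explored cluster of `a₂` are positively correlated. -/
theorem PDoL_mul_T'_le (p : E → R) (hp : IsProbVec p) (ends : E → Sym2 V) (o a₁ a₂ a₃ : V) :
    prob p (PDEvent ends a₁ a₂ a₃ ∩ connEvent ends a₁ o) * prob p (TEvent ends a₂ a₁ a₃) ≤
      prob p (TEvent ends a₂ a₁ a₃ ∩ connEvent ends a₁ o) * prob p (PDEvent ends a₁ a₂ a₃) := by
  have h := bhk_two_outside_avoid p hp ends a₂ a₁ a₁ ({a₁, a₃} : Finset V)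
    (isUpperSet_mem_setOf o) (isUpperSet_mem_setOf a₃)
  have hins : insert a₁ ({a₁, a₃} : Finset V) = {a₁, a₃} :=
    Finset.insert_eq_of_mem (Finset.mem_insert_self a₁ {a₃})
  simp only [hins] at h
  rw [← connEvent_eq_clusterInEvent ends a₁ o, ← connEvent_eq_clusterInEvent ends a₁ a₃,
    oL_inter_conn13_inter_R' ends o a₁ a₂ a₃, conn_inter_R ends a₂ a₁ a₃] at h
  -- `P(R′) = D + P(T′)` and `P(oL, R′) = P(PD, oL) + P(T′, oL)`
  have hR := ISplit.prob_PD_add_T p ends a₂ a₁ a₃ Set.univ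
  simp only [Set.inter_univ] at hR
  rw [PDEvent_symm ends a₁ a₂ a₃] at hR
  have hoR := ISplit.prob_PD_add_T p ends a₂ a₁ a₃ (connEvent ends a₁ o)
  rw [PDEvent_symm ends a₁ a₂ a₃] at hoR
  have e : connEvent ends a₁ o ∩ avoidAll ends a₂ {a₁, a₃} =
      avoidAll ends a₂ {a₁, a₃} ∩ connEvent ends a₁ o := Set.inter_comm _ _
  rw [e, ← hoR, ← hR] at h
  nlinarith [h]

/-- The root swap of `PDoL_mul_T'_le`: `P(PD, oH) · P(T) ≤ P(T, oH) · D` (`oH = {o ∈ C₂}`,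
`T = {a₃ ∈ C₂, a₁ ∉ C₂}`). -/
theorem PDoH_mul_T_le (p : E → R) (hp : IsProbVec p) (ends : E → Sym2 V) (o a₁ a₂ a₃ : V) :
    prob p (PDEvent ends a₁ a₂ a₃ ∩ connEvent ends a₂ o) * prob p (TEvent ends a₁ a₂ a₃) ≤
      prob p (TEvent ends a₁ a₂ a₃ ∩ connEvent ends a₂ o) * prob p (PDEvent ends a₁ a₂ a₃) := by
  have h := PDoL_mul_T'_le p hp ends o a₂ a₁ a₃
  rwa [PDEvent_symm ends a₁ a₂ a₃] at h

/-- The `oH` anti-correlation deficit of the closed pin is nonnegative: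
`0 ≤ P(PD, oH)·P(T′) − D·P(T′, oH)` (the margin block `DiagBA3.T'oH_mul_D_le`, BHK06 Thm 1.4). -/
theorem oH_deficit_nonneg (p : E → R) (hp : IsProbVec p) (ends : E → Sym2 V) (o a₁ a₂ a₃ : V) :
    0 ≤ prob p (PDEvent ends a₁ a₂ a₃ ∩ connEvent ends a₂ o) * prob p (TEvent ends a₂ a₁ a₃) -
        prob p (PDEvent ends a₁ a₂ a₃) * prob p (TEvent ends a₂ a₁ a₃ ∩ connEvent ends a₂ o) := by
  have h := DiagBA3.T'oH_mul_D_le p hp ends o a₁ a₂ a₃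
  linarith [h]

end OL

section Cross

variable {V : Type*} {E : Type*} [Fintype V] [DecidableEq V] [Fintype E] [DecidableEq E]
  {R : Type*} [Field R] [LinearOrder R] [IsStrictOrderedRing R]

variable {ends : E → Sym2 V} {e : E} {a₁ a₃ : V}

/-- **The cross term of the quartic's root-edge face, bounded below**: with the `oL` half signed,
`c ≥ D₀·P₀(PD, o ↔ a₃) + [D₀·P₀(T′, oH) − P₀(PD, oH)·P₀(T′)]` — the `a₃`-cluster mass of `o`
minus the `oH` anti-correlation deficit of the closed pin. -/
theorem covUm_root_ge (p : E → R) (hp : IsProbVec p) (hends : ends e = s(a₁, a₃)) (o a₂ : V) :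
    prob (Function.update p e 0) (PDEvent ends a₁ a₂ a₃) *
          prob (Function.update p e 0) (PDEvent ends a₁ a₂ a₃ ∩ connEvent ends a₃ o) +
        (prob (Function.update p e 0) (PDEvent ends a₁ a₂ a₃) *
            prob (Function.update p e 0) (TEvent ends a₂ a₁ a₃ ∩ connEvent ends a₂ o) -
          prob (Function.update p e 0) (PDEvent ends a₁ a₂ a₃ ∩ connEvent ends a₂ o) *
            prob (Function.update p e 0) (TEvent ends a₂ a₁ a₃)) ≤
      covUm p ends o a₁ a₂ a₃ e := by
  have hp₀ : IsProbVec (Function.update p e 0) := hp.update e le_rfl zero_le_one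
  have h := PDoL_mul_T'_le (Function.update p e 0) hp₀ ends o a₁ a₂ a₃
  rw [covUm_root_decomp p hends o a₂]
  unfold Do
  linarith [h]

/-- **The negative part of the cross term is at most the `oH` deficit**:
`0 ≤ c + [P₀(PD, oH)·P₀(T′) − D₀·P₀(T′, oH)]`. -/
theorem covUm_root_add_oH_deficit_nonneg (p : E → R) (hp : IsProbVec p)
    (hends : ends e = s(a₁, a₃)) (o a₂ : V) :
    0 ≤ covUm p ends o a₁ a₂ a₃ e +
        (prob (Function.update p e 0) (PDEvent ends a₁ a₂ a₃ ∩ connEvent ends a₂ o) *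
            prob (Function.update p e 0) (TEvent ends a₂ a₁ a₃) -
          prob (Function.update p e 0) (PDEvent ends a₁ a₂ a₃) *
            prob (Function.update p e 0) (TEvent ends a₂ a₁ a₃ ∩ connEvent ends a₂ o)) := by
  have hp₀ : IsProbVec (Function.update p e 0) := hp.update e le_rfl zero_le_one
  have h := covUm_root_ge p hp hends o a₂
  have hD := prob_nonneg hp₀ (PDEvent ends a₁ a₂ a₃)
  have h3 := prob_nonneg hp₀ (PDEvent ends a₁ a₂ a₃ ∩ connEvent ends a₃ o)
  nlinarith [h, mul_nonneg hD h3]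

end Cross

end QuarticRootCross

end Summit.Ventures.PercRepro2
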